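import Mathlib
import Summits.NavierStokesRegularity.NavierStokesRegularity.Theorems.FilamentSkeletonRssDefectColumnGateRadialBlockPrelim

/-!
# Route `FilamentSkeletonRss` · crux `TransverseReduction1AG` (stmt-NavierStokesRegularity-27853) · line `defect_column_gate_1AG` —
# the m = 0 RADIAL BLOCK of the localised sectional waist gate `WaistColumnGateLoc1A` (stub S2a-loc), with NO loss in `Rc` or `R`

Helper file (`--supports stmt-NavierStokesRegularity-27853 --as helper`; LEAD of 27853, lane ns-filament-21221-p1 g11; STUB BRIEFS v4, S2a-loc brief,
first helper target (ii) «the m = 0 radial block (total-derivative form `(1/r)(r f′ + (gam/2)r²f)′`, solvable by quadrature, constant `C(δ)`)»).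

THE BLOCK.  For the frozen waist column with SYMMETRIC sectional strain (`B_⊥ = −(γ/2)·Id` up to a sectional rotation, any rate `α`, any
circulation `Rc`) and an axisymmetric, axially constant swirl perturbation `W = v(r) e_θ` supported in the sectional disc `r ≤ R`, the axial
vorticity `ω(r)` is radial, the column terms of the kernel-checked identity `colForceVort_eq` (`Theorems/…ColumnVorticity.lean`, p651775) vanish
identically (`S·∇ω = 0`, `W·∇Ω_S = 0`, `∂_z S = ∂_z W = 0`), and the S2a-loc operator is the scalar radial Fokker–Planck block
`L₀ ω = −(Δ_⊥ω + (γ/2) ξ·∇ω + γ ω)`.  In the variable `u = r² = |ξ|²` (so that the sectional weight is `secWt = 1 + u` and `ω(ξ) = w(u)`):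
`Δ_⊥ω + (γ/2)ξ·∇ω + γω = 4u w″ + 4 w′ + γ u w′ + γ w = (4u w′ + γ u w)′` — a TOTAL DERIVATIVE.  Compact sectional support of `W` means
`w = 0` for `u ≥ U = R²` AND zero sectional mass `∫₀^U w = 0` (`r v(r) = ∫₀^r s ω(s) ds`).

THE ESTIMATE (`radialBlock_apriori`).  If `(1+u)²·|(4u w′ + γ u w)′| ≤ M` on `(0, ∞)`, `w = 0` on `[U, ∞)` and `∫₀^U w = 0`, then
`(1+u)²·|w(u)| ≤ (1 + 13/γ)²·M` for every `u ≥ 0` — uniformly in `U` (i.e. in the localisation radius `R`) and trivially in `Rc` (which does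
not enter the radial block); with `γ = κ − 3/2 ≥ δ` this is the brief's `C(δ) = (1 + 13/δ)²`.  So the «two-way m = 0 waveguide» named in the
crux's why-might-fail costs nothing at the sectional level.  `radialBlock_apriori_deriv2` is the same with the operator written out through a
second derivative `w″`.

THE PROOF (quadrature) and the one phenomenon worth recording.  With `φ := 4w′ + γw` and `Φ(u) := u·φ(u)`: `Φ′` is the operator, `Φ(0) = 0`,
and `Φ` vanishes beyond `U`; comparison (monotonicity — the datum is never integrated) gives `|Φ(u)| ≤ M·min(u,1)/(1+u) ≤ 2Mu/(1+u)²`, i.e.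
`|φ| ≤ 2M/(1+u)²`.  The first-order equation `w′ + (γ/4)w = φ/4` integrates with the factor `E = e^{γu/4}`:
`w(u) = e^{−γu/4}·(w(0) + ¼∫₀^u Eφ)`.  The KERNEL DIRECTION `e^{−γu/4}` (the Gaussian column itself, the mass mode) is invisible to the operator,
and the support condition `w(U) = 0` alone would force `w(0) = −¼∫₀^U Eφ`, of size `e^{γU/4}` — an exponential loss in `R`.  It is the ZERO-MASS
constraint that removes it: `∫₀^U w = (4w(0) + ∫₀^U φ)/γ` (from `w = (φ − 4w′)/γ`), so mass zero gives `w(0) = −¼∫₀^U φ`, `|w(0)| ≤ M/2`, and then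
`|w(u)| ≤ ½M e^{−γu/4} + ½M e^{−γu/8} + 8M/(γ(2+u)²)` by splitting `∫₀^u E(1+s)⁻²` at `u/2`; finally `(1+u)²e^{−cu} ≤ 1 + 4/c²`.

Preliminaries (`radialBlock_sq_mul_exp_neg_le`, `radialBlock_min_bound`, the two quadratures) live in `Theorems/…RadialBlockPrelim.lean`.
The statement is pure one-variable real analysis (hypotheses on `(0,∞)` plus continuity on `[0,∞)`, so that a radial profile `r ↦ ω(r)` of a
`C²` field can be fed in through `u = r²` without differentiability at `u = 0` from the left); the dictionary to `colForceVort`/`secWt` is the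
paragraph above and `Theorems/…Sectional2D.lean` (`colForceVort_streamField`).  HONEST FRAMING: elementary analysis about ONE block of ONE
linear MODEL operator of a hypothetical blow-up route (MODEL rung, negative side); `WaistColumnGateLoc1A`, `TransverseReduction1AG` are neither
proved nor refuted here; nothing in this file bears on Navier–Stokes regularity.
-/

set_option linter.dupNamespace false

noncomputable section

namespace Summit.NavierStokesRegularity.NavierStokesRegularity.Theorems.DefectColumnGate

open scoped Topology
open Set Filter MeasureTheory intervalIntegral

/-! ## 2. The radial block a-priori estimate -/

/-- **The m = 0 radial block of S2a-loc, no loss in the localisation radius.**  Data on `[0, ∞)` in the variable `u = r²`: `w` (the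
radial axial-vorticity profile) and `w₁` (its derivative on `(0,∞)`), both continuous on `[0,∞)`; the operator `(4u w₁ + γ u w)′ = f` on
`(0,∞)` with `(1+u)²|f| ≤ M`; support `w = 0` on `[U,∞)`; zero mass `∫₀^U w = 0`.  Conclusion: `(1+u)²|w(u)| ≤ (1 + 13/γ)² M` on `[0,∞)`. -/
theorem radialBlock_apriori {γ U M : ℝ} {w w₁ f : ℝ → ℝ} (hγ : 0 < γ) (hU : 0 < U)
    (hw : ContinuousOn w (Ici 0)) (hw₁ : ContinuousOn w₁ (Ici 0))
    (hder : ∀ u, 0 < u → HasDerivAt w (w₁ u) u)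
    (hΦ : ∀ u, 0 < u → HasDerivAt (fun s => 4 * s * w₁ s + γ * s * w s) (f u) u)
    (hf : ∀ u, 0 < u → (1 + u) ^ 2 * |f u| ≤ M)
    (hsupp : ∀ u, U ≤ u → w u = 0)
    (hmass : ∫ u in (0:ℝ)..U, w u = 0) :
    ∀ u, 0 ≤ u → (1 + u) ^ 2 * |w u| ≤ (1 + 13 / γ) ^ 2 * M := by
  -- the sign of `M`
  have hM : 0 ≤ M := le_trans (by positivity) (hf 1 one_pos)
  -- pointwise form of the datum bound
  have hfle : ∀ u, 0 < u → |f u| ≤ M / (1 + u) ^ 2 := fun u hu => by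
    rw [le_div_iff₀ (by positivity)]; linarith [hf u hu]
  -- names
  set Φ : ℝ → ℝ := fun s => 4 * s * w₁ s + γ * s * w s with hΦdef
  set φ : ℝ → ℝ := fun s => 4 * w₁ s + γ * w s with hφdef
  have hΦφ : ∀ s, Φ s = s * φ s := fun s => by simp only [hΦdef, hφdef]; ring
  have hΦ0 : Φ 0 = 0 := by simp [hΦdef]
  have hφcont : ContinuousOn φ (Ici 0) := (hw₁.const_smul (4:ℝ)).add (hw.const_smul γ) |>.congr (fun s _ => by
    simp [hφdef, smul_eq_mul])
  have hΦcont : ContinuousOn Φ (Ici 0) := by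
    have : ContinuousOn (fun s => s * φ s) (Ici 0) := continuousOn_id.mul hφcont
    exact this.congr (fun s _ => hΦφ s)
  -- Step 1: `w₁ = 0` strictly beyond `U` (derivative of a locally vanishing function), hence `Φ = 0` there
  have hw₁zero : ∀ u, U < u → w₁ u = 0 := by
    intro u hu
    have hev : (fun _ : ℝ => (0:ℝ)) =ᶠ[𝓝 u] w := by
      have : Ioi U ∈ 𝓝 u := Ioi_mem_nhds hu
      filter_upwards [this] with s hs
      exact (hsupp s (le_of_lt hs)).symm
    have h0 : HasDerivAt w 0 u := (hasDerivAt_const u (0:ℝ)).congr_of_eventuallyEq hev.symm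
    exact (hder u (hU.trans hu)).unique h0
  have hΦzero : ∀ u, U < u → Φ u = 0 := fun u hu => by
    simp only [hΦdef, hw₁zero u hu, hsupp u hu.le]; ring
  -- Step 2: comparison bounds for `Φ` on `[0, ∞)`
  have hinv : ∀ x, 0 < x → HasDerivAt (fun s : ℝ => M * (1 + s)⁻¹) (-(M / (1 + x) ^ 2)) x := by
    intro x hx
    have hx0 : (1 + x) ≠ 0 := by linarith
    have h1 : HasDerivAt (fun s : ℝ => 1 + s) 1 x := (hasDerivAt_id' x).const_add 1
    exact ((h1.inv hx0).const_mul M).congr_deriv (by ring)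
  have hcontInv : ContinuousOn (fun s : ℝ => M * (1 + s)⁻¹) (Ici 0) := by
    apply ContinuousOn.mul continuousOn_const
    apply ContinuousOn.inv₀ (by fun_prop)
    intro x hx; have : (0:ℝ) ≤ x := hx; linarith
  have hint : interior (Ici (0:ℝ)) = Ioi 0 := interior_Ici
  -- (2a) `|Φ u| ≤ M u/(1+u)`: `M − M/(1+s) ∓ Φ` are monotone on `[0,∞)` and vanish at `0`
  have h2a : ∀ u, 0 ≤ u → |Φ u| ≤ M * u / (1 + u) := by
    intro u hu
    have h1u : 0 < 1 + u := by linarith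
    have hmonoP : MonotoneOn (fun s => M - M * (1 + s)⁻¹ - Φ s) (Ici 0) := by
      apply monotoneOn_of_deriv_nonneg (convex_Ici 0)
      · exact (continuousOn_const.sub hcontInv).sub hΦcont
      · rw [hint]; intro x hx
        have hd : HasDerivAt (fun s => M - M * (1 + s)⁻¹ - Φ s) (0 - -(M / (1 + x) ^ 2) - f x) x :=
          ((hasDerivAt_const x M).sub (hinv x hx)).sub (hΦ x hx)
        exact hd.differentiableAt.differentiableWithinAt
      · rw [hint]; intro x hx
        have hd : HasDerivAt (fun s => M - M * (1 + s)⁻¹ - Φ s) (0 - -(M / (1 + x) ^ 2) - f x) x :=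
          ((hasDerivAt_const x M).sub (hinv x hx)).sub (hΦ x hx)
        rw [hd.deriv]
        have habs := abs_le.mp (hfle x hx)
        linarith [habs.2]
    have hmonoQ : MonotoneOn (fun s => M - M * (1 + s)⁻¹ + Φ s) (Ici 0) := by
      apply monotoneOn_of_deriv_nonneg (convex_Ici 0)
      · exact (continuousOn_const.sub hcontInv).add hΦcont
      · rw [hint]; intro x hx
        have hd : HasDerivAt (fun s => M - M * (1 + s)⁻¹ + Φ s) (0 - -(M / (1 + x) ^ 2) + f x) x :=
          ((hasDerivAt_const x M).sub (hinv x hx)).add (hΦ x hx)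
        exact hd.differentiableAt.differentiableWithinAt
      · rw [hint]; intro x hx
        have hd : HasDerivAt (fun s => M - M * (1 + s)⁻¹ + Φ s) (0 - -(M / (1 + x) ^ 2) + f x) x :=
          ((hasDerivAt_const x M).sub (hinv x hx)).add (hΦ x hx)
        rw [hd.deriv]
        have habs := abs_le.mp (hfle x hx)
        linarith [habs.1]
    have hp : M - M * (1 + (0:ℝ))⁻¹ - Φ 0 ≤ M - M * (1 + u)⁻¹ - Φ u := hmonoP self_mem_Ici hu hu
    have hq : M - M * (1 + (0:ℝ))⁻¹ + Φ 0 ≤ M - M * (1 + u)⁻¹ + Φ u := hmonoQ self_mem_Ici hu hu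
    have e1 : M - M * (1 + (0:ℝ))⁻¹ - Φ 0 = 0 := by rw [hΦ0]; norm_num
    have e2 : M - M * (1 + (0:ℝ))⁻¹ + Φ 0 = 0 := by rw [hΦ0]; norm_num
    rw [e1] at hp
    rw [e2] at hq
    have hMu : M - M * (1 + u)⁻¹ = M * u / (1 + u) := by field_simp; ring
    rw [hMu] at hp hq
    rw [abs_le]; constructor <;> linarith
  -- (2b) `|Φ u| ≤ M/(1+u)` (compare with a point beyond the support)
  have h2b : ∀ u, 0 ≤ u → |Φ u| ≤ M / (1 + u) := by
    intro u hu
    obtain ⟨u', huu', hUu'⟩ : ∃ u', u ≤ u' ∧ U < u' := ⟨max u U + 1, by linarith [le_max_left u U], by linarith [le_max_right u U]⟩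
    have hu'0 : 0 ≤ u' := hu.trans huu'
    have h1u' : 0 < 1 + u' := by linarith
    have hanti : AntitoneOn (fun s => Φ s + M * (1 + s)⁻¹) (Ici 0) := by
      apply antitoneOn_of_deriv_nonpos (convex_Ici 0)
      · exact hΦcont.add hcontInv
      · rw [hint]; intro x hx
        have hd : HasDerivAt (fun s => Φ s + M * (1 + s)⁻¹) (f x + -(M / (1 + x) ^ 2)) x := (hΦ x hx).add (hinv x hx)
        exact hd.differentiableAt.differentiableWithinAt
      · rw [hint]; intro x hx
        have hd : HasDerivAt (fun s => Φ s + M * (1 + s)⁻¹) (f x + -(M / (1 + x) ^ 2)) x := (hΦ x hx).add (hinv x hx)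
        rw [hd.deriv]
        have habs := abs_le.mp (hfle x hx)
        linarith [habs.2]
    have hmono : MonotoneOn (fun s => Φ s - M * (1 + s)⁻¹) (Ici 0) := by
      apply monotoneOn_of_deriv_nonneg (convex_Ici 0)
      · exact hΦcont.sub hcontInv
      · rw [hint]; intro x hx
        have hd : HasDerivAt (fun s => Φ s - M * (1 + s)⁻¹) (f x - -(M / (1 + x) ^ 2)) x := (hΦ x hx).sub (hinv x hx)
        exact hd.differentiableAt.differentiableWithinAt
      · rw [hint]; intro x hx
        have hd : HasDerivAt (fun s => Φ s - M * (1 + s)⁻¹) (f x - -(M / (1 + x) ^ 2)) x := (hΦ x hx).sub (hinv x hx)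
        rw [hd.deriv]
        have habs := abs_le.mp (hfle x hx)
        linarith [habs.1]
    have ha : Φ u' + M * (1 + u')⁻¹ ≤ Φ u + M * (1 + u)⁻¹ := hanti hu hu'0 huu'
    have hm : Φ u - M * (1 + u)⁻¹ ≤ Φ u' - M * (1 + u')⁻¹ := hmono hu hu'0 huu'
    rw [hΦzero u' hUu'] at ha hm
    have hpos' : 0 ≤ M * (1 + u')⁻¹ := mul_nonneg hM (inv_nonneg.mpr h1u'.le)
    rw [abs_le, div_eq_mul_inv]; constructor <;> linarith
  -- (2c) combined: `|Φ u| ≤ 2Mu/(1+u)²`, hence `|φ u| ≤ 2M/(1+u)²` for `u > 0`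
  have hφle : ∀ u, 0 < u → |φ u| ≤ 2 * M / (1 + u) ^ 2 := by
    intro u hu
    have h := radialBlock_min_bound hu.le (h2a u hu.le) (h2b u hu.le)
    rw [hΦφ, abs_mul, abs_of_pos hu] at h
    rw [le_div_iff₀ (by positivity)]
    rw [le_div_iff₀ (by positivity)] at h
    nlinarith
  -- Step 3: the integrating factor and the two FTC identities
  obtain ⟨E, hEdef⟩ : ∃ E : ℝ → ℝ, E = fun s => Real.exp (γ / 4 * s) := ⟨_, rfl⟩
  have hEpos : ∀ s, 0 < E s := fun s => by rw [hEdef]; exact Real.exp_pos _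
  have hEcont : Continuous E := by rw [hEdef]; fun_prop
  have hEderiv : ∀ x, HasDerivAt E (E x * (γ / 4)) x := fun x => by
    rw [hEdef]
    exact (((hasDerivAt_id' x).const_mul (γ / 4)).exp).congr_deriv (by simp only [mul_one])
  have hE0 : E 0 = 1 := by simp [hEdef]
  have hEmono : ∀ a b, a ≤ b → E a ≤ E b := fun a b hab => by
    simp only [hEdef]; exact Real.exp_le_exp.mpr (mul_le_mul_of_nonneg_left hab (by positivity))
  have hEinv : ∀ u, (E u)⁻¹ = Real.exp (-(γ / 4 * u)) := fun u => by simp only [hEdef, Real.exp_neg]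
  have hEhalf : ∀ u, (E u)⁻¹ * E (u / 2) = Real.exp (-(γ / 8 * u)) := fun u => by
    simp only [hEdef]
    rw [← Real.exp_neg, ← Real.exp_add]
    congr 1; ring
  have hEint : ∀ a b, ∫ s in a..b, E s = 4 / γ * (E b - E a) := fun a b => by
    simp only [hEdef]; exact radialBlock_integral_exp hγ.ne'
  -- (3a) `∫ₐᵇ Eφ/4 = E b w b − E a w a` for `0 ≤ a ≤ b`
  have hEφint : ∀ a b, 0 ≤ a → a ≤ b → IntervalIntegrable (fun s => E s * φ s / 4) volume a b := by
    intro a b ha hab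
    apply ContinuousOn.intervalIntegrable; rw [uIcc_of_le hab]
    exact (hEcont.continuousOn.mul (hφcont.mono (fun x hx => ha.trans hx.1))).div_const 4
  have hFTC : ∀ a b, 0 ≤ a → a ≤ b → ∫ s in a..b, E s * φ s / 4 = E b * w b - E a * w a := by
    intro a b ha hab
    have hcont : ContinuousOn (fun s => E s * w s) (Icc a b) :=
      hEcont.continuousOn.mul (hw.mono (fun x hx => ha.trans hx.1))
    have hderiv' : ∀ x ∈ Ioo a b, HasDerivAt (fun s => E s * w s) (E x * φ x / 4) x := by
      intro x hx
      have hx0 : 0 < x := ha.trans_lt hx.1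
      have hd : HasDerivAt (fun s => E s * w s) (E x * (γ / 4) * w x + E x * w₁ x) x := (hEderiv x).mul (hder x hx0)
      exact hd.congr_deriv (by simp only [hφdef]; ring)
    exact integral_eq_sub_of_hasDerivAt_of_le hab hcont hderiv' (hEφint a b ha hab)
  -- (3b) the mass identity: `γ ∫₀^U w = ∫₀^U φ − 4 (w U − w 0)`, so `w 0 = −(∫₀^U φ)/4`
  have hφint : ∀ a b, 0 ≤ a → a ≤ b → IntervalIntegrable φ volume a b := fun a b ha hab => by
    apply ContinuousOn.intervalIntegrable; rw [uIcc_of_le hab]; exact hφcont.mono (fun x hx => ha.trans hx.1)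
  have hw0 : w 0 = -(∫ s in (0:ℝ)..U, φ s) / 4 := by
    have hw₁int : IntervalIntegrable w₁ volume 0 U := by
      apply ContinuousOn.intervalIntegrable; rw [uIcc_of_le hU.le]; exact hw₁.mono (fun x hx => hx.1)
    have hFTCw : ∫ s in (0:ℝ)..U, w₁ s = w U - w 0 :=
      integral_eq_sub_of_hasDerivAt_of_le hU.le (hw.mono (fun x hx => hx.1)) (fun x hx => hder x hx.1) hw₁int
    have hid : ∫ s in (0:ℝ)..U, γ * w s = ∫ s in (0:ℝ)..U, (φ s - 4 * w₁ s) :=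
      intervalIntegral.integral_congr (fun x _ => by simp only [hφdef]; ring)
    rw [intervalIntegral.integral_const_mul, intervalIntegral.integral_sub (hφint 0 U le_rfl hU.le) (hw₁int.const_mul 4),
      intervalIntegral.integral_const_mul, hFTCw, hmass, hsupp U le_rfl] at hid
    linarith
  have hw0le : |w 0| ≤ M / 2 := by
    have hb : |∫ s in (0:ℝ)..U, φ s| ≤ ∫ s in (0:ℝ)..U, 2 * M * ((1 + s) ^ 2)⁻¹ := by
      have := norm_integral_le_of_norm_le (μ := volume) (f := φ) (g := fun s => 2 * M * ((1 + s) ^ 2)⁻¹) hU.le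
        (ae_of_all _ (fun t ht => by
          rw [Real.norm_eq_abs]; have := hφle t ht.1; rwa [div_eq_mul_inv] at this))
        (by apply ContinuousOn.intervalIntegrable; rw [uIcc_of_le hU.le]
            apply ContinuousOn.mul continuousOn_const
            apply ContinuousOn.inv₀ (by fun_prop)
            intro x hx; have : 0 < 1 + x := by linarith [hx.1]
            positivity)
      simpa only [Real.norm_eq_abs] using this
    rw [intervalIntegral.integral_const_mul, radialBlock_integral_inv_sq le_rfl hU.le] at hb
    have h1 : (1 + (0:ℝ))⁻¹ - (1 + U)⁻¹ ≤ 1 := by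
      have : 0 ≤ (1 + U)⁻¹ := inv_nonneg.mpr (by linarith)
      norm_num; linarith
    have h2 : |∫ s in (0:ℝ)..U, φ s| ≤ 2 * M :=
      calc |∫ s in (0:ℝ)..U, φ s| ≤ 2 * M * ((1 + (0:ℝ))⁻¹ - (1 + U)⁻¹) := hb
        _ ≤ 2 * M * 1 := mul_le_mul_of_nonneg_left h1 (by positivity)
        _ = 2 * M := by ring
    rw [hw0, abs_div, abs_neg, abs_of_pos (by norm_num : (0:ℝ) < 4)]
    linarith
  -- Step 4: `|∫₀^u Eφ/4| ≤ M E(u/2)/2 + 8 M E(u)/(γ (2+u)²)` for `u ≥ 0`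
  have hStep4 : ∀ u, 0 ≤ u →
      |∫ s in (0:ℝ)..u, E s * φ s / 4| ≤ M * E (u / 2) / 2 + 8 * M * E u / (γ * (2 + u) ^ 2) := by
    intro u hu
    have hu2 : 0 ≤ u / 2 := by positivity
    have hu2u : u / 2 ≤ u := by linarith
    rw [← integral_add_adjacent_intervals (hEφint 0 (u/2) le_rfl hu2) (hEφint (u/2) u hu2 hu2u)]
    -- piece A on `[0, u/2]`
    have hA : |∫ s in (0:ℝ)..(u/2), E s * φ s / 4| ≤ M * E (u / 2) / 2 := by
      have hb : |∫ s in (0:ℝ)..(u/2), E s * φ s / 4|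
          ≤ ∫ s in (0:ℝ)..(u/2), (E (u / 2) * M / 2) * ((1 + s) ^ 2)⁻¹ := by
        have := norm_integral_le_of_norm_le (μ := volume) (f := fun s => E s * φ s / 4)
          (g := fun s => (E (u / 2) * M / 2) * ((1 + s) ^ 2)⁻¹) hu2
          (ae_of_all _ (fun t ht => by
            rw [Real.norm_eq_abs, abs_div, abs_mul, abs_of_pos (hEpos t), abs_of_pos (by norm_num : (0:ℝ) < 4)]
            have h1 := hφle t ht.1
            have h2 : E t ≤ E (u / 2) := hEmono t (u/2) ht.2
            rw [div_eq_mul_inv] at h1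
            have h3 : E t * |φ t| ≤ E (u / 2) * (2 * M * ((1 + t) ^ 2)⁻¹) :=
              mul_le_mul h2 h1 (abs_nonneg _) (hEpos (u/2)).le
            have h4 : E (u / 2) * (2 * M * ((1 + t) ^ 2)⁻¹) / 4 = E (u / 2) * M / 2 * ((1 + t) ^ 2)⁻¹ := by ring
            linarith))
          (by apply ContinuousOn.intervalIntegrable; rw [uIcc_of_le hu2]
              apply ContinuousOn.mul continuousOn_const
              apply ContinuousOn.inv₀ (by fun_prop)
              intro x hx; have : 0 < 1 + x := by linarith [hx.1]
              positivity)
        simpa only [Real.norm_eq_abs] using this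
      rw [intervalIntegral.integral_const_mul, radialBlock_integral_inv_sq le_rfl hu2] at hb
      have h1 : (1 + (0:ℝ))⁻¹ - (1 + u / 2)⁻¹ ≤ 1 := by
        have : 0 ≤ (1 + u / 2)⁻¹ := inv_nonneg.mpr (by linarith)
        norm_num at this ⊢; linarith
      have hc : 0 ≤ E (u / 2) * M / 2 := by have := hEpos (u/2); positivity
      calc |∫ s in (0:ℝ)..(u/2), E s * φ s / 4| ≤ (E (u / 2) * M / 2) * ((1 + (0:ℝ))⁻¹ - (1 + u / 2)⁻¹) := hb
        _ ≤ (E (u / 2) * M / 2) * 1 := mul_le_mul_of_nonneg_left h1 hc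
        _ = M * E (u / 2) / 2 := by ring
    -- piece B on `[u/2, u]`
    have hB : |∫ s in (u/2)..u, E s * φ s / 4| ≤ 8 * M * E u / (γ * (2 + u) ^ 2) := by
      have hb : |∫ s in (u/2)..u, E s * φ s / 4| ≤ ∫ s in (u/2)..u, (2 * M / (2 + u) ^ 2) * E s := by
        have := norm_integral_le_of_norm_le (μ := volume) (f := fun s => E s * φ s / 4)
          (g := fun s => (2 * M / (2 + u) ^ 2) * E s) hu2u
          (ae_of_all _ (fun t ht => by
            rw [Real.norm_eq_abs, abs_div, abs_mul, abs_of_pos (hEpos t), abs_of_pos (by norm_num : (0:ℝ) < 4)]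
            have ht0 : 0 < t := lt_of_le_of_lt hu2 ht.1
            have h1 := hφle t ht0
            -- `(1+t)² ≥ (1+u/2)² = (2+u)²/4`
            have h2 : 2 * M / (1 + t) ^ 2 ≤ 8 * M / (2 + u) ^ 2 := by
              rw [div_le_div_iff₀ (by positivity) (by positivity)]
              have : (2 + u) ^ 2 ≤ 4 * (1 + t) ^ 2 := by nlinarith [ht.1]
              nlinarith
            have h3 : E t * |φ t| ≤ E t * (8 * M / (2 + u) ^ 2) := mul_le_mul_of_nonneg_left (h1.trans h2) (hEpos t).le
            have h4 : E t * (8 * M / (2 + u) ^ 2) / 4 = 2 * M / (2 + u) ^ 2 * E t := by ring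
            linarith))
          (by apply Continuous.intervalIntegrable; exact continuous_const.mul hEcont)
        simpa only [Real.norm_eq_abs] using this
      rw [intervalIntegral.integral_const_mul, hEint] at hb
      have h3 : 4 / γ * (E u - E (u / 2)) ≤ 4 / γ * E u := by
        have := hEpos (u/2)
        have h4 : 0 ≤ 4 / γ := by positivity
        nlinarith
      have hc : 0 ≤ 2 * M / (2 + u) ^ 2 := by positivity
      calc |∫ s in (u/2)..u, E s * φ s / 4| ≤ 2 * M / (2 + u) ^ 2 * (4 / γ * (E u - E (u / 2))) := hb
        _ ≤ 2 * M / (2 + u) ^ 2 * (4 / γ * E u) := mul_le_mul_of_nonneg_left h3 hc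
        _ = 8 * M * E u / (γ * (2 + u) ^ 2) := by field_simp; ring
    calc |(∫ s in (0:ℝ)..(u/2), E s * φ s / 4) + ∫ s in (u/2)..u, E s * φ s / 4|
        ≤ |∫ s in (0:ℝ)..(u/2), E s * φ s / 4| + |∫ s in (u/2)..u, E s * φ s / 4| := abs_add_le _ _
      _ ≤ M * E (u / 2) / 2 + 8 * M * E u / (γ * (2 + u) ^ 2) := add_le_add hA hB
  -- Step 5: assemble
  intro u hu
  by_cases huU : u ≤ U
  swap
  · -- beyond the support
    have hUu : U ≤ u := le_of_not_ge huU
    rw [hsupp u hUu, abs_zero, mul_zero]; positivity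
  · have hrep : E u * w u = w 0 + ∫ s in (0:ℝ)..u, E s * φ s / 4 := by
      have := hFTC 0 u le_rfl hu
      rw [hE0, one_mul] at this; linarith
    have hEu := hEpos u
    -- `|w u| ≤ E(u)⁻¹ (M/2 + M E(u/2)/2) + 8 M /(γ(2+u)²)`
    have hwu : |w u| ≤ (E u)⁻¹ * (M / 2 + M * E (u / 2) / 2) + 8 * M / (γ * (2 + u) ^ 2) := by
      have h1 : |E u * w u| ≤ M / 2 + (M * E (u / 2) / 2 + 8 * M * E u / (γ * (2 + u) ^ 2)) := by
        rw [hrep]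
        exact (abs_add_le _ _).trans (add_le_add hw0le (hStep4 u hu))
      rw [abs_mul, abs_of_pos hEu] at h1
      have h2 : |w u| ≤ (E u)⁻¹ * (M / 2 + (M * E (u / 2) / 2 + 8 * M * E u / (γ * (2 + u) ^ 2))) := by
        rw [le_inv_mul_iff₀ hEu]; exact h1
      have h3 : (E u)⁻¹ * (M / 2 + (M * E (u / 2) / 2 + 8 * M * E u / (γ * (2 + u) ^ 2)))
          = (E u)⁻¹ * (M / 2 + M * E (u / 2) / 2) + 8 * M / (γ * (2 + u) ^ 2) := by
        have hEne : E u ≠ 0 := hEu.ne'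
        field_simp
        ring
      linarith [h3]
    -- the two exponential factors
    have hex1 : (1 + u) ^ 2 * (E u)⁻¹ ≤ 1 + 64 / γ ^ 2 := by
      have h := radialBlock_sq_mul_exp_neg_le (c := γ / 4) (u := u) (by positivity) hu
      rw [hEinv]
      calc (1 + u) ^ 2 * Real.exp (-(γ / 4 * u)) ≤ 1 + 4 / (γ / 4) ^ 2 := h
        _ = 1 + 64 / γ ^ 2 := by field_simp; ring
    have hex2 : (1 + u) ^ 2 * ((E u)⁻¹ * E (u / 2)) ≤ 1 + 256 / γ ^ 2 := by
      have h := radialBlock_sq_mul_exp_neg_le (c := γ / 8) (u := u) (by positivity) hu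
      rw [hEhalf]
      calc (1 + u) ^ 2 * Real.exp (-(γ / 8 * u)) ≤ 1 + 4 / (γ / 8) ^ 2 := h
        _ = 1 + 256 / γ ^ 2 := by field_simp; ring
    have hrat : (1 + u) ^ 2 * (8 * M / (γ * (2 + u) ^ 2)) ≤ 8 * M / γ := by
      rw [mul_div_assoc', div_le_div_iff₀ (by positivity) hγ]
      have : (1 + u) ^ 2 ≤ (2 + u) ^ 2 := by nlinarith
      calc (1 + u) ^ 2 * (8 * M) * γ = (8 * M) * γ * (1 + u) ^ 2 := by ring
        _ ≤ (8 * M) * γ * (2 + u) ^ 2 := mul_le_mul_of_nonneg_left this (by positivity)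
        _ = 8 * M * (γ * (2 + u) ^ 2) := by ring
    -- final arithmetic
    have hsq : 0 ≤ (1 + u) ^ 2 := by positivity
    have hM2 : 0 ≤ M / 2 := by positivity
    calc (1 + u) ^ 2 * |w u|
        ≤ (1 + u) ^ 2 * ((E u)⁻¹ * (M / 2 + M * E (u / 2) / 2) + 8 * M / (γ * (2 + u) ^ 2)) :=
          mul_le_mul_of_nonneg_left hwu hsq
      _ = (M / 2) * ((1 + u) ^ 2 * (E u)⁻¹) + (M / 2) * ((1 + u) ^ 2 * ((E u)⁻¹ * E (u / 2)))
            + (1 + u) ^ 2 * (8 * M / (γ * (2 + u) ^ 2)) := by ring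
      _ ≤ (M / 2) * (1 + 64 / γ ^ 2) + (M / 2) * (1 + 256 / γ ^ 2) + 8 * M / γ :=
          add_le_add (add_le_add (mul_le_mul_of_nonneg_left hex1 hM2) (mul_le_mul_of_nonneg_left hex2 hM2)) hrat
      _ = (1 + 8 / γ + 160 / γ ^ 2) * M := by ring
      _ ≤ (1 + 13 / γ) ^ 2 * M := by
          apply mul_le_mul_of_nonneg_right _ hM
          have h1 : 0 ≤ 1 / γ := by positivity
          have h13 : (1 + 13 / γ) ^ 2 = 1 + 26 * (1 / γ) + 169 * (1 / γ) ^ 2 := by ring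
          have h8 : 1 + 8 / γ + 160 / γ ^ 2 = 1 + 8 * (1 / γ) + 160 * (1 / γ) ^ 2 := by ring
          rw [h13, h8]
          nlinarith [h1, sq_nonneg (1 / γ)]

/-- **The same radial block with the operator written out**: `f = 4u w″ + 4 w′ + γ u w′ + γ w` (`= Δ_⊥ω + (γ/2)ξ·∇ω + γω` at
`ω(ξ) = w(|ξ|²)`), `w′ = w₁`, `w″ = w₂` on `(0,∞)`; conclusion `(1+u)²|w| ≤ (1+13/γ)²·M` on `[0,∞)`, no loss in `U = R²`. -/
theorem radialBlock_apriori_deriv2 {γ U M : ℝ} {w w₁ w₂ : ℝ → ℝ} (hγ : 0 < γ) (hU : 0 < U)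
    (hw : ContinuousOn w (Ici 0)) (hw₁ : ContinuousOn w₁ (Ici 0))
    (hder : ∀ u, 0 < u → HasDerivAt w (w₁ u) u) (hder₂ : ∀ u, 0 < u → HasDerivAt w₁ (w₂ u) u)
    (hf : ∀ u, 0 < u → (1 + u) ^ 2 * |4 * u * w₂ u + 4 * w₁ u + γ * u * w₁ u + γ * w u| ≤ M)
    (hsupp : ∀ u, U ≤ u → w u = 0)
    (hmass : ∫ u in (0:ℝ)..U, w u = 0) :
    ∀ u, 0 ≤ u → (1 + u) ^ 2 * |w u| ≤ (1 + 13 / γ) ^ 2 * M := by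
  refine radialBlock_apriori (f := fun u => 4 * u * w₂ u + 4 * w₁ u + γ * u * w₁ u + γ * w u) hγ hU hw hw₁ hder ?_ hf hsupp hmass
  intro u hu
  have h1 : HasDerivAt (fun s : ℝ => 4 * s) 4 u := by
    simpa using (hasDerivAt_id' u).const_mul (4:ℝ)
  have h2 : HasDerivAt (fun s : ℝ => γ * s) γ u := by
    simpa using (hasDerivAt_id' u).const_mul γ
  have hd : HasDerivAt (fun s => 4 * s * w₁ s + γ * s * w s)
      (4 * w₁ u + 4 * u * w₂ u + (γ * w u + γ * u * w₁ u)) u :=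
    (h1.mul (hder₂ u hu)).add (h2.mul (hder u hu))
  exact hd.congr_deriv (by ring)

end Summit.NavierStokesRegularity.NavierStokesRegularity.Theorems.DefectColumnGate

end
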